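import Summits.BirchSwinnertonDyer.BirchSwinnertonDyer.Theses.BiquadraticEisensteinDescent
import Literature.NumberTheory.EllipticCurves.AnalyticRankModularityProofs
import Literature.NumberTheory.EllipticCurves.DeuringSupersingularReductionHoldsProofs
import HarnessLib

/-!
# Route `BiquadraticEisensteinDescent` (W-ALL row 12, CM inert-bad corner): the support `PublishedInputsBiquadratic`
# (stmt-BirchSwinnertonDyer-20243) from NINE named facts, losslessly, and the deciding theorem's printed-input list
# one name shorter — `EntireLFunctionRat` (19273) ⟸ `NewformOfEllipticCurve` (19382)

Cell `bsd-inputs` (D-0154 KEY (146) §C / (154)(c), INPUTS-LIST-1 row BED p2 = B8 «reduce»), seat `bsd-inputs-bed-p2`,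
`--supports stmt-BirchSwinnertonDyer-20243`. This module imports the route file (its hypotheses and conclusions ARE route decls,
by name), so no `_holds` link can be stated here.

The support `PublishedInputsBiquadratic` is the conjunction of the eleven published inputs the deciding theorem `closes`
consumes. Two of the eleven are consequences of the rest in the kernel:

* conjunct 5, `WeierstrassCurve.hasEntireLFunction_rat` (split child `EntireLFunctionRat`, item 19273: `L(E, s)` has an entire
  continuation for every `E / ℚ`), follows from conjunct 6, `ModularForms.exists_isNewformOf` (split child
  `NewformOfEllipticCurve`, item 19382: Modularity Theorem, Version `L`), by the tree THEOREM
  `WeierstrassCurve.hasEntireLFunction_rat_of_exists_isNewformOf` (`Literature/…/AnalyticRankModularityProofs.lean`: Hecke's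
  continuation of `L(f, s)` for the newform `f` of `E`, Diamond–Shurman Thm. 5.10.2 after Thm. 8.8.3, in-kernel);
* conjunct 10, Deuring's criterion `deuring_not_hasUnitRootAt_of_hasCM_of_not_cmSplit`, is the tree THEOREM
  `deuring_not_hasUnitRootAt_of_hasCM_of_not_cmSplit_holds` (`Literature/…/DeuringSupersingularReductionHoldsProofs.lean`).

ALREADY LANDED ELSEWHERE (reused, not restated): the by-name implication «19382 ⇒ 19273» is
`Summit.BirchSwinnertonDyer.BirchSwinnertonDyer.Theorems.entireLFunctionRat_of_newformOfEllipticCurve`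
(`Theorems/ErratumRoadFivePublishedInputsSurface.lean`, same bodies as this route's like-named decls), and the parent from SEVEN
of its eight split children is `…Theorems.BiquadraticEisensteinDescentPublishedInputsBiquadraticOfPartsReduced.publishedInputsBiquadratic_of_seven`
(width seat bsd-wall-cm-bed-w2). Neither module is imported (no Theorems-on-Theorems cone over the route file): where the seven
children are the hypotheses below, they are fed to `publishedInputsBiquadratic_of_nine` componentwise (each child IS its
Literature constant by definition).

## What this file adds (bookkeeping for the BED pen ∕ the §C inputs record; nothing booked)

* §1 `entireLFunctionRat_and_newformOfEllipticCurve_iff` — the displayed PAIR of modularity inputs (19273, 19382) collapses to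
  19382 alone.
* §2 `publishedInputsBiquadratic_of_nine` — **the parent ⟸ NINE named facts, each ONE Literature constant** (no route vocabulary
  in the hypotheses): Gross–Zagier, Kolyvagin, Matar–Nekovář Thm 0.3 (the three `∀ N W K` families), GZK (rank = analytic
  rank ≤ 1), modularity (newform), Friedberg–Hoffstein (split Heegner field with non-vanishing twist), the rank-0 CM triple,
  Edixhoven's Manin theorem, Cassels' isogeny invariance of the BSD quotient.
* §3 `publishedInputsBiquadratic_iff_nine`, `publishedInputsBiquadratic_iff_seven` — the reduction is LOSSLESS: the
  eleven-conjunct parent is EQUIVALENT to the conjunction of the nine facts, resp. of the seven split children other than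
  `EntireLFunctionRat` (so a re-split of 20243 without 19273 displays an equivalent, one-name-shorter list).
* §4 `wAllCornerFInertBad_of_items_of_nine` — the route's deciding theorem `closes` with its binder
  `h6 : PublishedInputsBiquadratic` REBUILT from the nine atoms, every other binder verbatim: the leaf
  `Summit.BirchSwinnertonDyer.WAllCornerFInertBad` from the route's other eight `closes` items BY NAME plus the nine named facts —
  the displayed printed-input list of this `closes` is one name shorter (19273 gone; Deuring already a theorem), kernel-certified;
  and `wAllCornerFInertBad_of_items_of_seven`, the same over the seven split children.

HONEST FRAMING: THEOREMS ONLY (0 definitions, 0 named facts, 0 `sorry`); every statement is CONDITIONAL on the listed items ∕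
named facts taken as hypotheses; no published input is proved here — in particular neither modularity nor the entire
continuation is proved, the latter is only DERIVED from the former AS TYPED; item 19273 is not closed; nothing is booked; BSD is
proved for no pair; no census word, tier or label moves.

References: [DiamondShurman2005] Thm. 8.8.3, Thm. 5.10.2, §8.8; [BCDTJAMS2001] Theorem A; [Lang1987] Ch. 13 §4 Thm. 12 (Deuring).
-/

set_option autoImplicit false
-- the Theorems namespace of this sub repeats the summit name by design (D-0017 nested layout)
set_option linter.dupNamespace false

open Literature.NumberTheory.EllipticCurves Literature.NumberTheory.EllipticCurves.ModularForms
open Summit.BirchSwinnertonDyer.BirchSwinnertonDyer.Theses.BiquadraticEisensteinDescent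

namespace Summit.BirchSwinnertonDyer.BirchSwinnertonDyer.Theorems.BiquadraticEisensteinDescentPublishedInputsBiquadraticOfNine

/-! ### §1 The pair of modularity inputs collapses -/

/-- **Split children 19273 ∧ 19382 from 19382 alone**: the pair of modularity inputs this route displays
(`EntireLFunctionRat`, `NewformOfEllipticCurve`) is EQUIVALENT to the single input `NewformOfEllipticCurve` — Modularity Theorem,
Version `L` ⇒ `L(E, s)` entire for every `E / ℚ`, the tree theorem `WeierstrassCurve.hasEntireLFunction_rat_of_exists_isNewformOf`
(Hecke's continuation of `L(f, s)`, in-kernel). CONDITIONAL on 19382; 19273 is thereby a consequence of 19382 AS TYPED, not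
proved; nothing booked. [cite: DiamondShurman2005, Thm. 8.8.3 and Thm. 5.10.2] [cite: BCDTJAMS2001, Theorem A] -/
theorem entireLFunctionRat_and_newformOfEllipticCurve_iff : (EntireLFunctionRat ∧ NewformOfEllipticCurve) ↔ NewformOfEllipticCurve :=
  ⟨fun h ↦ h.2, fun hnf ↦ ⟨WeierstrassCurve.hasEntireLFunction_rat_of_exists_isNewformOf hnf, hnf⟩⟩

/-! ### §2 The parent 20243 from nine named facts (atomised; no route vocabulary in the hypotheses) -/

/-- **Support 20243 `PublishedInputsBiquadratic` from NINE named facts, each ONE Literature constant**: the three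
`∀ N W K` families Gross–Zagier 1986 (`gross_zagier`), Kolyvagin 1990 (`kolyvagin`), Matar–Nekovář 2019 Thm 0.3
(`MatarNekovar2019.thm03_padicValNat_card_sha_le_of_irreducible`); GZK rank = analytic rank ≤ 1
(`rank_eq_analyticRank_of_analyticRank_le_one`); Modularity Version `L` (`ModularForms.exists_isNewformOf`); Friedberg–Hoffstein
(`friedbergHoffstein_exists_heegnerField_split_twist_ne_zero`); the rank-0 CM triple (`bsdTriple_of_hasCM_of_L_one_ne_zero`);
Edixhoven's Manin theorem (`ModularForms.edixhoven_not_dvd_maninConstant_of_not_potentiallyGoodOrdinary`); Cassels' isogeny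
invariance (`WeierstrassCurve.bsdRHS_eq_of_isIsogenous`). The two remaining conjuncts are supplied by the tree theorems
`WeierstrassCurve.hasEntireLFunction_rat_of_exists_isNewformOf` (conjunct 5 from conjunct 6) and
`deuring_not_hasUnitRootAt_of_hasCM_of_not_cmSplit_holds` (conjunct 10). CONDITIONAL on the nine; no fact is proved here;
nothing booked. [cite: DiamondShurman2005, Thm. 8.8.3 and Thm. 5.10.2] [cite: Lang1987, Ch. 13 §4 Thm. 12] -/
theorem publishedInputsBiquadratic_of_nine
    (hGZ : ∀ (N : ℕ) [NeZero N] (W : WeierstrassCurve ℚ) (K : Type) [Field K] [NumberField K], gross_zagier N W K)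
    (hKo : ∀ (N : ℕ) [NeZero N] (W : WeierstrassCurve ℚ) (K : Type) [Field K] [NumberField K], kolyvagin N W K)
    (hMN : ∀ (N : ℕ) [NeZero N] (W : WeierstrassCurve ℚ) (K : Type) [Field K] [NumberField K],
      MatarNekovar2019.thm03_padicValNat_card_sha_le_of_irreducible N W K)
    (hGZK : rank_eq_analyticRank_of_analyticRank_le_one) (hnf : exists_isNewformOf)
    (hFH : friedbergHoffstein_exists_heegnerField_split_twist_ne_zero) (hCM8 : bsdTriple_of_hasCM_of_L_one_ne_zero)
    (hEdx : edixhoven_not_dvd_maninConstant_of_not_potentiallyGoodOrdinary)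
    (hCassels : WeierstrassCurve.bsdRHS_eq_of_isIsogenous) : PublishedInputsBiquadratic :=
  ⟨hGZ, hKo, hMN, hGZK, WeierstrassCurve.hasEntireLFunction_rat_of_exists_isNewformOf hnf, hnf, hFH, hCM8, hEdx,
    deuring_not_hasUnitRootAt_of_hasCM_of_not_cmSplit_holds, hCassels⟩

/-! ### §3 The reduction is lossless -/

/-- **`PublishedInputsBiquadratic` (eleven conjuncts) is EQUIVALENT to the conjunction of the NINE named facts of
`publishedInputsBiquadratic_of_nine`** (same order, conjuncts 5 and 10 deleted): dropping `hasEntireLFunction_rat` and Deuring's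
criterion from the displayed list loses nothing. [cite: DiamondShurman2005, Thm. 8.8.3 and Thm. 5.10.2] [cite: Lang1987, Ch. 13 §4 Thm. 12] -/
theorem publishedInputsBiquadratic_iff_nine :
    PublishedInputsBiquadratic ↔
      ((∀ (N : ℕ) [NeZero N] (W : WeierstrassCurve ℚ) (K : Type) [Field K] [NumberField K], gross_zagier N W K) ∧
        (∀ (N : ℕ) [NeZero N] (W : WeierstrassCurve ℚ) (K : Type) [Field K] [NumberField K], kolyvagin N W K) ∧
        (∀ (N : ℕ) [NeZero N] (W : WeierstrassCurve ℚ) (K : Type) [Field K] [NumberField K],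
          MatarNekovar2019.thm03_padicValNat_card_sha_le_of_irreducible N W K) ∧
        rank_eq_analyticRank_of_analyticRank_le_one ∧ exists_isNewformOf ∧
        friedbergHoffstein_exists_heegnerField_split_twist_ne_zero ∧ bsdTriple_of_hasCM_of_L_one_ne_zero ∧
        edixhoven_not_dvd_maninConstant_of_not_potentiallyGoodOrdinary ∧ WeierstrassCurve.bsdRHS_eq_of_isIsogenous) :=
  ⟨fun ⟨hGZ, hKo, hMN, hGZK, _, hnf, hFH, hCM8, hEdx, _, hCassels⟩ ↦ ⟨hGZ, hKo, hMN, hGZK, hnf, hFH, hCM8, hEdx, hCassels⟩,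
    fun ⟨hGZ, hKo, hMN, hGZK, hnf, hFH, hCM8, hEdx, hCassels⟩ ↦
      publishedInputsBiquadratic_of_nine hGZ hKo hMN hGZK hnf hFH hCM8 hEdx hCassels⟩

/-- The same equivalence in the split-children vocabulary: the parent holds iff the SEVEN children other than
`EntireLFunctionRat` hold (`ClassicalInputsBiquadratic`, `RankEqAnalyticRankLeOne`, `NewformOfEllipticCurve`,
`FriedbergHoffsteinHeegnerSplitTwist`, `CMRankZeroBSDTriple`, `EdixhovenManinNonPotOrdinary`, `BSDQuotientIsogenyInvariance`).
[cite: DiamondShurman2005, Thm. 8.8.3 and Thm. 5.10.2] [cite: Lang1987, Ch. 13 §4 Thm. 12] -/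
theorem publishedInputsBiquadratic_iff_seven :
    PublishedInputsBiquadratic ↔
      (ClassicalInputsBiquadratic ∧ RankEqAnalyticRankLeOne ∧ NewformOfEllipticCurve ∧ FriedbergHoffsteinHeegnerSplitTwist ∧
        CMRankZeroBSDTriple ∧ EdixhovenManinNonPotOrdinary ∧ BSDQuotientIsogenyInvariance) :=
  ⟨fun ⟨hGZ, hKo, hMN, hGZK, _, hnf, hFH, hCM8, hEdx, _, hCassels⟩ ↦
      ⟨⟨hGZ, hKo, hMN⟩, hGZK, hnf, hFH, hCM8, hEdx, hCassels⟩,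
    fun ⟨h1, h2, h4, h5, h6, h7, h8⟩ ↦ publishedInputsBiquadratic_of_nine h1.1 h1.2.1 h1.2.2 h2 h4 h5 h6 h7 h8⟩

/-! ### §4 The deciding theorem with `h6` rebuilt — the printed-input list one name shorter -/

/-- **THE DECIDING THEOREM `closes` OF ROUTE `BiquadraticEisensteinDescent` WITH ITS BINDER `h6 : PublishedInputsBiquadratic`
ATOMISED AND REDUCED.** The leaf `Summit.BirchSwinnertonDyer.WAllCornerFInertBad` (BSD(E, p) on the CM inert-bad corner) from
the route's other eight `closes` items BY NAME — `EisensteinDivisibilityCMInertBadFlatAtOneKPrime` (20710),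
`KatzWaldspurgerFrameCMInertBadFlatKPrimeOfLZZ` (20712, closed), `InertBadAtThree` (19225), `ManinDatumFiveSevenCMInert` (20242),
`HeegnerFieldSupplyCMInertBadKPrime` (20713), `HsiehAnyLevelInput` (20456), `HsiehMuInvariantInput` (20711),
`LiuZhangZhangAdditiveInput` (20316) — plus the NINE named facts of §2 (no `hasEntireLFunction_rat`, no Deuring). Proof =
`closes` with `h6 := publishedInputsBiquadratic_of_nine …`, every other binder verbatim. CONDITIONAL on all seventeen
hypotheses; nothing booked; BSD is proved for no pair; no census word, tier or label moves.
[cite: DiamondShurman2005, Thm. 8.8.3 and Thm. 5.10.2] [cite: Lang1987, Ch. 13 §4 Thm. 12] -/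
theorem wAllCornerFInertBad_of_items_of_nine
    -- the route's other `closes` items, by name
    (h1 : EisensteinDivisibilityCMInertBadFlatAtOneKPrime) (h2 : KatzWaldspurgerFrameCMInertBadFlatKPrimeOfLZZ)
    (h4 : InertBadAtThree) (h5 : ManinDatumFiveSevenCMInert) (h7 : HeegnerFieldSupplyCMInertBadKPrime)
    (h8 : HsiehAnyLevelInput) (h9 : HsiehMuInvariantInput) (h10 : LiuZhangZhangAdditiveInput)
    -- the nine named facts replacing `h6 : PublishedInputsBiquadratic`
    (hGZ : ∀ (N : ℕ) [NeZero N] (W : WeierstrassCurve ℚ) (K : Type) [Field K] [NumberField K], gross_zagier N W K)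
    (hKo : ∀ (N : ℕ) [NeZero N] (W : WeierstrassCurve ℚ) (K : Type) [Field K] [NumberField K], kolyvagin N W K)
    (hMN : ∀ (N : ℕ) [NeZero N] (W : WeierstrassCurve ℚ) (K : Type) [Field K] [NumberField K],
      MatarNekovar2019.thm03_padicValNat_card_sha_le_of_irreducible N W K)
    (hGZK : rank_eq_analyticRank_of_analyticRank_le_one) (hnf : exists_isNewformOf)
    (hFH : friedbergHoffstein_exists_heegnerField_split_twist_ne_zero) (hCM8 : bsdTriple_of_hasCM_of_L_one_ne_zero)
    (hEdx : edixhoven_not_dvd_maninConstant_of_not_potentiallyGoodOrdinary)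
    (hCassels : WeierstrassCurve.bsdRHS_eq_of_isIsogenous) : Summit.BirchSwinnertonDyer.WAllCornerFInertBad :=
  closes h1 h2 h4 h5 (publishedInputsBiquadratic_of_nine hGZ hKo hMN hGZK hnf hFH hCM8 hEdx hCassels) h7 h8 h9 h10

/-- **The same over the split children**: the leaf from the route's other eight `closes` items plus the SEVEN children of 20243
other than `EntireLFunctionRat` (19273), fed componentwise to `publishedInputsBiquadratic_of_nine`. CONDITIONAL on all
fifteen hypotheses; nothing booked; BSD is proved for no pair. [cite: DiamondShurman2005, Thm. 8.8.3 and Thm. 5.10.2]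
[cite: Lang1987, Ch. 13 §4 Thm. 12] -/
theorem wAllCornerFInertBad_of_items_of_seven
    (h1 : EisensteinDivisibilityCMInertBadFlatAtOneKPrime) (h2 : KatzWaldspurgerFrameCMInertBadFlatKPrimeOfLZZ)
    (h4 : InertBadAtThree) (h5 : ManinDatumFiveSevenCMInert) (h7 : HeegnerFieldSupplyCMInertBadKPrime)
    (h8 : HsiehAnyLevelInput) (h9 : HsiehMuInvariantInput) (h10 : LiuZhangZhangAdditiveInput)
    (c1 : ClassicalInputsBiquadratic) (c2 : RankEqAnalyticRankLeOne) (c4 : NewformOfEllipticCurve)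
    (c5 : FriedbergHoffsteinHeegnerSplitTwist) (c6 : CMRankZeroBSDTriple) (c7 : EdixhovenManinNonPotOrdinary)
    (c8 : BSDQuotientIsogenyInvariance) : Summit.BirchSwinnertonDyer.WAllCornerFInertBad :=
  closes h1 h2 h4 h5 (publishedInputsBiquadratic_of_nine c1.1 c1.2.1 c1.2.2 c2 c4 c5 c6 c7 c8) h7 h8 h9 h10

end Summit.BirchSwinnertonDyer.BirchSwinnertonDyer.Theorems.BiquadraticEisensteinDescentPublishedInputsBiquadraticOfNine
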